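import Literature.ModelTheory.ExponentialFields.OMinimalIntervals
import Literature.ModelTheory.ExponentialFields.OMinimalDefinability
import Mathlib.Topology.ContinuousOn
import Mathlib.Order.Interval.Set.OrdConnected
import HarnessLib

/-!
# Definably connected sets (van den Dries, Ch. 1, (3.5)–(3.6))

Topic `Literature/ModelTheory/ExponentialFields`.  L. van den Dries, *Tame topology and
o-minimal structures* (1998), Ch. 1, (3.5): a definable set `X ⊆ R^m` is **definably
connected** if it is not the union of two disjoint non-empty definable open subsets of `X`;
and (3.6): in an o-minimal structure the intervals (and points) of the line are definably
connected — "by (3.3)(i)", the definable Dedekind completeness.  These are the inputs of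
Ch. 3, (2.9) (cells are definably connected) and of Claims 1–2 in the proof of the uniform
finiteness property (2.13).

* `inter_nonempty_of_ordConnected` — **(3.6)** in the line, for an arbitrary order-convex
  `S ⊆ M` (intervals with or without endpoints, rays, points): two definable subsets of `M`,
  each open relative to `S` (in the order sense), which cover `S` and both meet `S`, meet each
  other inside `S`.  Proof: the least upper bound (`IsFiniteUnionOfIntervals.exists_isLUB`) of
  the definable set of `x ∈ [u, v]` with `[u, x] ⊆ U`, for `u ∈ S ∩ U < v ∈ S ∩ V`, lies in
  `S ∩ U ∩ V`;
* `DefinablyConnected L S` for `S ⊆ M^α` (product topology): the relative form of (3.5) —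
  definable `U, V ⊆ M^α` that are neighbourhoods within `S` of each of their points in `S`,
  cover `S` and both meet `S` must meet inside `S`; `DefinablyConnected.subset_of_clopen` — a
  definable relatively clopen subset meeting `S` contains `S`.

Nothing here is a named fact.

## References

* [Dries1998] L. van den Dries, *Tame topology and o-minimal structures*, London Math. Soc.
  Lecture Note Series 248, CUP 1998, Ch. 1, (3.5), (3.6).
-/

open Set FirstOrder FirstOrder.Language
open _root_.Filter _root_.Topology

namespace Literature.ModelTheory.ExponentialFields

universe u v

variable {L : Language.{u, v}} {M : Type*} [L.Structure M]

/-! ### (3.6): order-convex subsets of the line are definably connected -/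

section Line

variable [LinearOrder M] [DenselyOrdered M] [NoMinOrder M] [NoMaxOrder M]

/-- The one-sided core of (3.6): with `u ∈ S ∩ U`, `v ∈ S ∩ V`, `u < v`, the sets `U`, `V`
definable and open relative to the order-convex `S`, and `S ∩ U ∩ V = ∅`, a contradiction
(the supremum of `{x ∈ [u, v] : [u, x] ⊆ U}` can lie neither in `U` nor in `V`). [cite: Dries1998, Ch. 1 (3.6)] -/
theorem false_of_lt_of_ordConnected (hO : L.IsOMinimal M)
    (hlt : (univ : Set M).Definable L {v : Fin 2 → M | v 0 < v 1}) {S U V : Set M}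
    (hS : S.OrdConnected) (hU : (univ : Set M).Definable₁ L U)
    (hUo : ∀ x ∈ S ∩ U, ∃ a b, a < x ∧ x < b ∧ Ioo a b ∩ S ⊆ U)
    (hVo : ∀ x ∈ S ∩ V, ∃ a b, a < x ∧ x < b ∧ Ioo a b ∩ S ⊆ V)
    (hcov : S ⊆ U ∪ V) (hdis : ∀ x ∈ S, x ∈ U → x ∉ V)
    {u v : M} (hu : u ∈ S ∩ U) (hv : v ∈ S ∩ V) (huv : u < v) : False := by
  -- the definable set of `x ∈ [u, v]` with `[u, x] ⊆ U`
  set W : Set M := {x | u ≤ x ∧ x ≤ v ∧ ∀ y, u ≤ y → y ≤ x → y ∈ U} with hW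
  have hWdef : (univ : Set M).Definable₁ L W := by
    refine definable_setOf_and (definable_setOf_le hlt (definableFun_const' _ u)
      (definableFun_proj _)) (definable_setOf_and (definable_setOf_le hlt
      (definableFun_proj _) (definableFun_const' _ v)) ?_)
    apply definable_setOf_forall
    exact definable_setOf_imp (definable_setOf_le hlt (definableFun_const' _ u)
      (definableFun_proj _)) (definable_setOf_imp (definable_setOf_le hlt
      (definableFun_proj _) (definableFun_proj _)) (hU.preimage_comp fun _ : Fin 1 => Sum.inr ()))
  have huW : u ∈ W := ⟨le_rfl, huv.le, fun y h₁ h₂ => by rw [le_antisymm h₂ h₁]; exact hu.2⟩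
  obtain ⟨c, hc⟩ := (hO W hWdef).exists_isLUB ⟨u, huW⟩ ⟨v, fun x hx => hx.2.1⟩
  have huc : u ≤ c := hc.1 huW
  have hcv : c ≤ v := hc.2 fun x hx => hx.2.1
  have hIS : Icc u v ⊆ S := hS.out hu.1 hv.1
  have hcS : c ∈ S := hIS ⟨huc, hcv⟩
  -- below `c`, everything from `u` on lies in `U`
  have hbelow : ∀ y, u ≤ y → y < c → y ∈ U := by
    intro y huy hyc
    obtain ⟨w, hwW, hyw⟩ := (lt_isLUB_iff hc).1 hyc
    exact hwW.2.2 y huy hyw.le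
  rcases hcov hcS with hcU | hcV
  · -- `c ∈ U`: `U` reaches beyond `c`, contradicting `c = sup W` (or `c = v ∈ U ∩ V`)
    obtain ⟨a, b, hac, hcb, hsub⟩ := hUo c ⟨hcS, hcU⟩
    rcases hcv.lt_or_eq with hcv' | hcv'
    · obtain ⟨x, hcx, hx⟩ := exists_between (lt_min hcb hcv')
      have hxW : x ∈ W := by
        refine ⟨huc.trans hcx.le, (lt_of_lt_of_le hx (min_le_right _ _)).le, fun y huy hyx => ?_⟩
        rcases lt_trichotomy y c with hyc | rfl | hcy
        · exact hbelow y huy hyc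
        · exact hcU
        · exact hsub ⟨⟨hac.trans hcy, lt_of_le_of_lt hyx (lt_of_lt_of_le hx (min_le_left _ _))⟩,
            hIS ⟨huy, hyx.trans (lt_of_lt_of_le hx (min_le_right _ _)).le⟩⟩
      exact absurd (hc.1 hxW) (not_le.2 hcx)
    · exact hdis c hcS hcU (hcv' ▸ hv.2)
  · -- `c ∈ V`: `V` reaches below `c` into `U`
    obtain ⟨a, b, hac, hcb, hsub⟩ := hVo c ⟨hcS, hcV⟩
    rcases huc.lt_or_eq with huc' | huc'
    · obtain ⟨y, hy₁, hyc⟩ := exists_between (max_lt hac huc')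
      have hyU : y ∈ U := hbelow y (lt_of_le_of_lt (le_max_right _ _) hy₁).le hyc
      have hyV : y ∈ V := hsub ⟨⟨lt_of_le_of_lt (le_max_left _ _) hy₁, hyc.trans hcb⟩,
        hIS ⟨(lt_of_le_of_lt (le_max_right _ _) hy₁).le, hyc.le.trans hcv⟩⟩
      exact hdis y (hIS ⟨(lt_of_le_of_lt (le_max_right _ _) hy₁).le, hyc.le.trans hcv⟩) hyU hyV
    · exact hdis c hcS (huc' ▸ hu.2) hcV

/-- **(3.6) Order-convex subsets of the line are definably connected** (van den Dries 1998,
Ch. 1, (3.6): "the intervals are definably connected … also each set `{a}`"): in an o-minimal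
structure on a dense linear order without endpoints (`<` definable), if two definable subsets
`U, V` of `M`, each open relative to an order-convex set `S` in the order sense, cover `S` and
both meet `S`, then `S ∩ U ∩ V ≠ ∅`. [cite: Dries1998, Ch. 1 (3.6)] -/
theorem inter_nonempty_of_ordConnected (hO : L.IsOMinimal M)
    (hlt : (univ : Set M).Definable L {v : Fin 2 → M | v 0 < v 1}) {S U V : Set M}
    (hS : S.OrdConnected) (hU : (univ : Set M).Definable₁ L U)
    (hV : (univ : Set M).Definable₁ L V)
    (hUo : ∀ x ∈ S ∩ U, ∃ a b, a < x ∧ x < b ∧ Ioo a b ∩ S ⊆ U)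
    (hVo : ∀ x ∈ S ∩ V, ∃ a b, a < x ∧ x < b ∧ Ioo a b ∩ S ⊆ V)
    (hcov : S ⊆ U ∪ V) (hu : (S ∩ U).Nonempty) (hv : (S ∩ V).Nonempty) :
    (S ∩ (U ∩ V)).Nonempty := by
  by_contra hempty
  have hdis : ∀ x ∈ S, x ∈ U → x ∉ V := fun x hxS hxU hxV => hempty ⟨x, hxS, hxU, hxV⟩
  obtain ⟨u, hu⟩ := hu
  obtain ⟨v, hv⟩ := hv
  rcases lt_trichotomy u v with huv | rfl | hvu
  · exact false_of_lt_of_ordConnected hO hlt hS hU hUo hVo hcov hdis hu hv huv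
  · exact hdis u hu.1 hu.2 hv.2
  · exact false_of_lt_of_ordConnected hO hlt hS hV hVo hUo (fun x hx => (hcov hx).symm)
      (fun x hxS hxV hxU => hdis x hxS hxU hxV) hv hu hvu

end Line

/-! ### Definably connected subsets of `M^α` -/

section Product

variable [TopologicalSpace M] {α : Type*}

variable (L) in
/-- **Definably connected** sets (van den Dries 1998, Ch. 1, (3.5): "`X` is not the union of
two disjoint nonempty definable open subsets of `X`"), in the relative form for `S ⊆ M^α` with
the product topology: whenever definable `U, V ⊆ M^α` are neighbourhoods within `S` of each of
their points in `S` (i.e. `S ∩ U`, `S ∩ V` are open in `S`), cover `S` and both meet `S`, they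
meet inside `S`.  (Definability of `S` itself is not required by the definition.) [cite: Dries1998, Ch. 1 (3.5)] -/
def DefinablyConnected (S : Set (α → M)) : Prop :=
  ∀ U V : Set (α → M), (univ : Set M).Definable L U → (univ : Set M).Definable L V →
    (∀ x ∈ S ∩ U, U ∈ 𝓝[S] x) → (∀ x ∈ S ∩ V, V ∈ 𝓝[S] x) →
    S ⊆ U ∪ V → (S ∩ U).Nonempty → (S ∩ V).Nonempty → (S ∩ (U ∩ V)).Nonempty

/-- Unfolding `DefinablyConnected`. [cite: Dries1998, Ch. 1 (3.5)] -/
theorem definablyConnected_iff {S : Set (α → M)} : DefinablyConnected L S ↔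
    ∀ U V : Set (α → M), (univ : Set M).Definable L U → (univ : Set M).Definable L V →
      (∀ x ∈ S ∩ U, U ∈ 𝓝[S] x) → (∀ x ∈ S ∩ V, V ∈ 𝓝[S] x) →
      S ⊆ U ∪ V → (S ∩ U).Nonempty → (S ∩ V).Nonempty → (S ∩ (U ∩ V)).Nonempty :=
  Iff.rfl

/-- The empty set is definably connected. [folklore] -/
theorem definablyConnected_empty : DefinablyConnected L (∅ : Set (α → M)) :=
  fun _ _ _ _ _ _ _ hu _ => by simp at hu

/-- Singletons are definably connected. [cite: Dries1998, Ch. 1 (3.6)] -/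
theorem definablyConnected_singleton (x : α → M) : DefinablyConnected L ({x} : Set (α → M)) := by
  intro U V _ _ _ _ _ hu hv
  obtain ⟨y, hy, hyU⟩ := hu
  obtain ⟨z, hz, hzV⟩ := hv
  rw [mem_singleton_iff] at hy hz
  rw [hy] at hyU
  rw [hz] at hzV
  exact ⟨x, rfl, hyU, hzV⟩

/-- **A definable relatively clopen subset meeting a definably connected set contains it**
(van den Dries 1998, Ch. 3, proof of (2.13), Claim 2: "the set `{a ∈ A : |Y_a| = k}` is
open and closed in `A`, hence `|Y_a| = k` for all `a ∈ A`"). [cite: Dries1998, Ch. 1 (3.5)] -/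
theorem DefinablyConnected.subset_of_clopen {S T : Set (α → M)} (hS : DefinablyConnected L S)
    (hT : (univ : Set M).Definable L T) (hopen : ∀ x ∈ S ∩ T, T ∈ 𝓝[S] x)
    (hclosed : ∀ x ∈ S \ T, Tᶜ ∈ 𝓝[S] x) (hne : (S ∩ T).Nonempty) : S ⊆ T := by
  intro x hx
  by_contra hxT
  obtain ⟨y, hyS, hyT, hyT'⟩ := hS T Tᶜ hT hT.compl hopen (fun x hx => hclosed x ⟨hx.1, hx.2⟩)
    (fun y _ => em (y ∈ T)) hne ⟨x, hx, hxT⟩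
  exact hyT' hyT

end Product

end Literature.ModelTheory.ExponentialFields
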